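import Summits.CriticalPhenomena.CardyFormulaZ2.Theorems.CardyBoundaryCoulombGasRectilinearCardyClosureDefs
import Summits.CriticalPhenomena.CardyFormulaZ2.Theorems.RectilinearCardy.Negative.RectilinearCardyReductions
import Literature.Probability.RandomPlanarGeometry.ChordalCurveFamily
import Literature.Probability.Percolation.LatticeSymmetry
import HarnessLib

/-!
# Stub `stub_conjGeometry` of line `excursion-kernel-covariance`
# (crux `RectilinearCardy`, stmt-CriticalPhenomena-5660, route `CardyBoundaryCoulombGas`):
# the complex-conjugate copy of a conformal rectangle

Statement. (1) Every conformal rectangle `R = (Ω; a, b, c, d)` has a complex-conjugate copy `R'`: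
carrier `{z | conj z ∈ Ω}`, boundary loop `t ↦ conj (∂Ω(t))`, the same marks. (2) Along this relation
the copy inherits rectilinearity (`IsRectilinear`), flat marks (`FlatMarks`), admissible windows
(`AdmissibleRange`); the orientation predicate at the flat mark `a = pt 0` passes from "carrier on the
LEFT of the axis direction `u`" to "carrier on the RIGHT of the direction `conj u`"; and the lattice
reflection `v ↦ (v₀, -v₁)` carries the boundary row of the closure polygon `V_δ(R)` into that of
`V_δ(R')`.

Proof. (1) is the tree's image construction `MarkedDomain.map` (ChordalCurveFamily) applied to the
conjugation homeomorphism `Complex.conjLIE.toHomeomorph`; `conj '' Ω = {z | conj z ∈ Ω}` because `conj`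
is an involution. (2) `conj` is an isometric `ℝ`-linear involutive homeomorphism of `ℂ`: it carries
frontier/closure of `Ω` to those of the copy (`Homeomorph.preimage_frontier/closure`), segments to
segments, preserves `re` and `dist`, negates `im`; `R'.pt i = conj (R.pt i)`;
`(conj ζ) / (conj u) = conj (ζ / u)`. On the lattice, `meshPoint δ (v₀, -v₁) = conj (meshPoint δ v)` and
the reflection is the graph automorphism `reflectIso 1` of `ℤ²` (LatticeSymmetry), so it maps the outer
neighbours of `v` in `V_δ(R)` bijectively onto those of `(v₀, -v₁)` in `V_δ(R')`. Elementary; no source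
beyond the definitions (Werner 2007 §3 for conformal rectangles).
-/

noncomputable section

open Set Filter Topology MeasureTheory Metric
open ComplexConjugate
open Literature.Probability.RandomPlanarGeometry
open Literature.Probability.LatticeModels (Site meshPoint zdGraph)
open Summit.CriticalPhenomena.CardyFormulaZ2.Theorems.RectilinearCardy.Negative (IsRectilinear)

namespace Summit.CriticalPhenomena.CardyFormulaZ2.Cruxes.RectilinearCardy.ExcursionKernelCovariance

/-! ### Existence of the conjugate copy -/

/-- **Existence of the complex-conjugate copy** of a conformal rectangle: the image of `R` under the
conjugation homeomorphism of the plane (`MarkedDomain.map`), with carrier `{z | conj z ∈ Ω}`, loop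
`conj ∘ ∂Ω` and the same marks. [folklore] -/
theorem conjGeom_exists (R : ConformalRectangle) : ∃ R' : ConformalRectangle,
    (∀ z : ℂ, z ∈ R'.carrier ↔ (starRingEnd ℂ) z ∈ R.carrier) ∧
      (∀ t : ℝ, R'.boundary t = (starRingEnd ℂ) (R.boundary t)) ∧ (∀ i : Fin 4, R'.mark i = R.mark i) := by
  refine ⟨R.map Complex.conjLIE.toHomeomorph, fun z => ?_, fun t => rfl, fun i => rfl⟩
  rw [MarkedDomain.carrier_map]
  constructor
  · rintro ⟨w, hw, rfl⟩
    simpa using hw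
  · intro h
    exact ⟨conj z, h, by simp⟩

/-! ### Transfer along the conjugation relation: plane geometry -/

section Transfer

variable {R R' : ConformalRectangle}

/-- The carrier of the copy is the preimage of the carrier under conjugation. [folklore] -/
theorem conjGeom_carrier_eq (hc : ∀ z : ℂ, z ∈ R'.carrier ↔ (starRingEnd ℂ) z ∈ R.carrier) :
    R'.carrier = Complex.conjLIE.toHomeomorph ⁻¹' R.carrier := by
  ext z
  exact hc z

/-- Frontier of the copy: `z ∈ ∂Ω' ↔ conj z ∈ ∂Ω` (conjugation is a homeomorphism). [folklore] -/
theorem conjGeom_mem_frontier_iff (hc : ∀ z : ℂ, z ∈ R'.carrier ↔ (starRingEnd ℂ) z ∈ R.carrier)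
    (z : ℂ) : z ∈ frontier R'.carrier ↔ (starRingEnd ℂ) z ∈ frontier R.carrier := by
  rw [conjGeom_carrier_eq hc, ← Homeomorph.preimage_frontier]
  rfl

/-- Closure of the copy: `z ∈ closure Ω' ↔ conj z ∈ closure Ω` (conjugation is a homeomorphism).
[folklore] -/
theorem conjGeom_mem_closure_iff (hc : ∀ z : ℂ, z ∈ R'.carrier ↔ (starRingEnd ℂ) z ∈ R.carrier)
    (z : ℂ) : z ∈ closure R'.carrier ↔ (starRingEnd ℂ) z ∈ closure R.carrier := by
  rw [conjGeom_carrier_eq hc, ← Homeomorph.preimage_closure]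
  rfl

/-- The marked points of the copy are the conjugates of the marked points. [folklore] -/
theorem conjGeom_pt_eq (hb : ∀ t : ℝ, R'.boundary t = (starRingEnd ℂ) (R.boundary t))
    (hm : ∀ i : Fin 4, R'.mark i = R.mark i) (i : Fin 4) : R'.pt i = (starRingEnd ℂ) (R.pt i) := by
  show R'.boundary (R'.mark i) = (starRingEnd ℂ) (R.boundary (R.mark i))
  rw [hm i, hb]

/-- `dist z (conj w) = dist (conj z) w` (conjugation is an isometric involution). [folklore] -/
theorem conjGeom_dist_conj_right (z w : ℂ) :
    dist z ((starRingEnd ℂ) w) = dist ((starRingEnd ℂ) z) w := by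
  rw [← Complex.dist_conj_conj, Complex.conj_conj]

/-- Conjugation maps real segments to real segments (it is `ℝ`-linear). [folklore] -/
theorem conjGeom_conj_mem_segment {a b z : ℂ} (h : z ∈ segment ℝ a b) :
    (starRingEnd ℂ) z ∈ segment ℝ ((starRingEnd ℂ) a) ((starRingEnd ℂ) b) := by
  obtain ⟨s, t, hs, ht, hst, rfl⟩ := h
  refine ⟨s, t, hs, ht, hst, ?_⟩
  simp [Complex.real_smul, map_add, map_mul, Complex.conj_ofReal]

/-- **Rectilinearity transfers to the copy**: conjugate the finitely many axis-parallel segments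
covering `∂Ω`. [folklore] -/
theorem conjGeom_isRectilinear (hc : ∀ z : ℂ, z ∈ R'.carrier ↔ (starRingEnd ℂ) z ∈ R.carrier) :
    IsRectilinear R → IsRectilinear R' := by
  classical
  rintro ⟨S, hS, hfr⟩
  refine ⟨S.image (Prod.map (starRingEnd ℂ) (starRingEnd ℂ)), ?_, ?_⟩
  · intro p hp
    obtain ⟨q, hq, rfl⟩ := Finset.mem_image.1 hp
    rcases hS q hq with h | h
    · left
      simp [h]
    · right
      simp [h]
  · intro z hz
    have hz' := (conjGeom_mem_frontier_iff hc z).1 hz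
    obtain ⟨p, hp, hzp⟩ := mem_iUnion₂.1 (hfr hz')
    refine mem_iUnion₂.2 ⟨Prod.map (starRingEnd ℂ) (starRingEnd ℂ) p, Finset.mem_image_of_mem _ hp, ?_⟩
    have := conjGeom_conj_mem_segment hzp
    rwa [Complex.conj_conj] at this

/-- **Flatness transfers to the copy**: `FlatNear R z r → FlatNear R' (conj z) r` (conjugation
preserves `re` and distances and negates `im`, so each of the two disjuncts is preserved). [folklore] -/
theorem conjGeom_flatNear (hc : ∀ z : ℂ, z ∈ R'.carrier ↔ (starRingEnd ℂ) z ∈ R.carrier) {z : ℂ}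
    {r : ℝ} (h : FlatNear R z r) : FlatNear R' ((starRingEnd ℂ) z) r := by
  rcases h with h | h
  · left
    intro z' hz' hd
    have h1 := h _ ((conjGeom_mem_frontier_iff hc z').1 hz') (by rwa [← conjGeom_dist_conj_right])
    rw [Complex.conj_im] at h1
    rw [Complex.conj_im]
    linarith
  · right
    intro z' hz' hd
    have h1 := h _ ((conjGeom_mem_frontier_iff hc z').1 hz') (by rwa [← conjGeom_dist_conj_right])
    rw [Complex.conj_re] at h1
    rw [Complex.conj_re]
    exact h1

/-- **Flat marks transfer to the copy.** [folklore] -/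
theorem conjGeom_flatMarks (hc : ∀ z : ℂ, z ∈ R'.carrier ↔ (starRingEnd ℂ) z ∈ R.carrier)
    (hb : ∀ t : ℝ, R'.boundary t = (starRingEnd ℂ) (R.boundary t))
    (hm : ∀ i : Fin 4, R'.mark i = R.mark i) (h : FlatMarks R) : FlatMarks R' := by
  intro i
  obtain ⟨r, hr, hf⟩ := h i
  refine ⟨r, hr, ?_⟩
  rw [conjGeom_pt_eq hb hm]
  exact conjGeom_flatNear hc hf

/-- **Admissible windows transfer to the copy** (same marks; flatness along the window transfers).
[folklore] -/
theorem conjGeom_admissibleRange (hc : ∀ z : ℂ, z ∈ R'.carrier ↔ (starRingEnd ℂ) z ∈ R.carrier)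
    (hb : ∀ t : ℝ, R'.boundary t = (starRingEnd ℂ) (R.boundary t))
    (hm : ∀ i : Fin 4, R'.mark i = R.mark i) (σ σ' : ℝ) (h : AdmissibleRange R σ σ') :
    AdmissibleRange R' σ σ' := by
  obtain ⟨h1, h2, h3, r, hr, hf⟩ := h
  refine ⟨by rw [hm]; exact h1, h2, by rw [hm]; exact h3, r, hr, fun s hs => ?_⟩
  rw [hb]
  exact conjGeom_flatNear hc (hf s hs)

/-- Conjugates of the four axis directions are axis directions. [folklore] -/
theorem conjGeom_axisDir {u : ℂ} (hu : u = 1 ∨ u = Complex.I ∨ u = -1 ∨ u = -Complex.I) :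
    (starRingEnd ℂ) u = 1 ∨ (starRingEnd ℂ) u = Complex.I ∨ (starRingEnd ℂ) u = -1 ∨
      (starRingEnd ℂ) u = -Complex.I := by
  rcases hu with rfl | rfl | rfl | rfl
  · exact Or.inl (map_one _)
  · exact Or.inr (Or.inr (Or.inr Complex.conj_I))
  · exact Or.inr (Or.inr (Or.inl (by rw [map_neg, map_one])))
  · exact Or.inr (Or.inl (by rw [map_neg, Complex.conj_I, neg_neg]))

/-- **The orientation at `a = pt 0` flips**: if the loop of `R` moves forward in the axis direction
`u` through `a` with the carrier on the LEFT (`0 < im`), then the loop of the copy moves forward in the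
direction `conj u` through `conj a` with the carrier on the RIGHT (`0 < -im`):
`(conj ζ) / (conj u) = conj (ζ / u)` has the same real part and the opposite imaginary part. [folklore] -/
theorem conjGeom_orientation (hc : ∀ z : ℂ, z ∈ R'.carrier ↔ (starRingEnd ℂ) z ∈ R.carrier)
    (hb : ∀ t : ℝ, R'.boundary t = (starRingEnd ℂ) (R.boundary t))
    (hm : ∀ i : Fin 4, R'.mark i = R.mark i)
    (h : ∃ u : ℂ, (u = 1 ∨ u = Complex.I ∨ u = -1 ∨ u = -Complex.I) ∧ ∃ r : ℝ, 0 < r ∧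
      (∀ t t' : ℝ, R.mark 0 - r < t → t < t' → t' < R.mark 0 + r →
        0 < ((R.boundary t' - R.boundary t) / u).re ∧
          ((R.boundary t' - R.boundary t) / u).im = 0) ∧
      (∀ z : ℂ, dist z (R.pt 0) < r →
        (z ∈ R.carrier ↔ 0 < ((z - R.pt 0) / u).im))) :
    ∃ u : ℂ, (u = 1 ∨ u = Complex.I ∨ u = -1 ∨ u = -Complex.I) ∧ ∃ r : ℝ, 0 < r ∧
      (∀ t t' : ℝ, R'.mark 0 - r < t → t < t' → t' < R'.mark 0 + r →
        0 < ((R'.boundary t' - R'.boundary t) / u).re ∧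
          ((R'.boundary t' - R'.boundary t) / u).im = 0) ∧
      (∀ z : ℂ, dist z (R'.pt 0) < r →
        (z ∈ R'.carrier ↔ 0 < -((z - R'.pt 0) / u).im)) := by
  obtain ⟨u, hu, r, hr, hdir, hside⟩ := h
  refine ⟨(starRingEnd ℂ) u, conjGeom_axisDir hu, r, hr, fun t t' h1 h2 h3 => ?_, fun z hz => ?_⟩
  · rw [hm] at h1 h3
    obtain ⟨hre, him⟩ := hdir t t' h1 h2 h3
    rw [hb, hb, ← map_sub, ← map_div₀, Complex.conj_re, Complex.conj_im, him, neg_zero]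
    exact ⟨hre, rfl⟩
  · rw [conjGeom_pt_eq hb hm] at hz ⊢
    rw [conjGeom_dist_conj_right] at hz
    rw [hc z, hside _ hz]
    have key : (z - (starRingEnd ℂ) (R.pt 0)) / (starRingEnd ℂ) u =
        (starRingEnd ℂ) (((starRingEnd ℂ) z - R.pt 0) / u) := by
      rw [map_div₀, map_sub, Complex.conj_conj]
    rw [key, Complex.conj_im, neg_neg]

end Transfer

/-! ### Transfer along the conjugation relation: the boundary row of the closure polygon -/

/-- The lattice reflection `x ↦ (x₀, -x₁)` of `ℤ²` is the tree's graph automorphism `reflectIso 1`.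
[folklore] -/
theorem conjGeom_reflectIso_one_apply (x : Site 2) :
    Literature.Probability.Percolation.reflectIso (1 : Fin 2) x = ![x 0, -x 1] := by
  ext i
  fin_cases i
  · simp [Literature.Probability.Percolation.reflectIso_apply_of_ne (show (0 : Fin 2) ≠ 1 by decide)]
  · simp

/-- The lattice reflection preserves adjacency in `ℤ²`. [folklore] -/
theorem conjGeom_adj_refl_iff (x y : Site 2) :
    (zdGraph 2).Adj (![x 0, -x 1]) (![y 0, -y 1]) ↔ (zdGraph 2).Adj x y := by
  rw [← conjGeom_reflectIso_one_apply, ← conjGeom_reflectIso_one_apply]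
  exact (Literature.Probability.Percolation.reflectIso (1 : Fin 2)).map_adj_iff

/-- The lattice reflection is an involution. [folklore] -/
theorem conjGeom_refl_refl (x : Site 2) :
    (![(![x 0, -x 1] : Site 2) 0, -(![x 0, -x 1] : Site 2) 1] : Site 2) = x := by
  ext i
  fin_cases i <;> simp

/-- The mesh point of the reflected site is the conjugate mesh point. [folklore] -/
theorem conjGeom_meshPoint_refl (δ : ℝ) (x : Site 2) :
    meshPoint δ (![x 0, -x 1] : Site 2) = (starRingEnd ℂ) (meshPoint δ x) := by
  apply Complex.ext <;> simp

/-- The reflection carries the closure polygon `V_δ(R)` onto `V_δ(R')` (`δ > 0`). [folklore] -/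
theorem conjGeom_refl_mem_closureFinset_iff {R R' : ConformalRectangle}
    (hc : ∀ z : ℂ, z ∈ R'.carrier ↔ (starRingEnd ℂ) z ∈ R.carrier) {δ : ℝ} (hδ : 0 < δ)
    (x : Site 2) : (![x 0, -x 1] : Site 2) ∈ closureFinset R' δ ↔ x ∈ closureFinset R δ := by
  rw [mem_closureFinset_iff R' hδ, mem_closureFinset_iff R hδ, conjGeom_meshPoint_refl,
    conjGeom_mem_closure_iff hc, Complex.conj_conj]

/-- The same, read from the side of the copy: `x ∈ V_δ(R') ↔ (x₀, -x₁) ∈ V_δ(R)`. [folklore] -/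
theorem conjGeom_mem_closureFinset_iff_refl {R R' : ConformalRectangle}
    (hc : ∀ z : ℂ, z ∈ R'.carrier ↔ (starRingEnd ℂ) z ∈ R.carrier) {δ : ℝ} (hδ : 0 < δ)
    (x : Site 2) : x ∈ closureFinset R' δ ↔ (![x 0, -x 1] : Site 2) ∈ closureFinset R δ := by
  rw [← conjGeom_refl_mem_closureFinset_iff hc hδ, conjGeom_refl_refl]

/-- **The boundary row transfers**: the reflection of a boundary-row vertex of `V_δ(R)` is a
boundary-row vertex of `V_δ(R')` (the reflection is a graph automorphism of `ℤ²` carrying `V_δ(R)`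
onto `V_δ(R')`, so it maps the outer neighbours of `v` bijectively onto those of `(v₀, -v₁)`).
[folklore] -/
theorem conjGeom_boundaryRow {R R' : ConformalRectangle}
    (hc : ∀ z : ℂ, z ∈ R'.carrier ↔ (starRingEnd ℂ) z ∈ R.carrier) (δ : ℝ) (v : Site 2)
    (hv : v ∈ boundaryRow R δ) : (![v 0, -v 1] : Site 2) ∈ boundaryRow R' δ := by
  rcases le_or_gt δ 0 with hδ | hδ
  · have h := boundaryRow_subset R δ hv
    rw [closureFinset_of_nonpos R hδ] at h
    simp at h
  · rw [mem_boundaryRow_iff] at hv ⊢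
    obtain ⟨hv1, hv2⟩ := hv
    refine ⟨(conjGeom_refl_mem_closureFinset_iff hc hδ v).2 hv1, Eq.trans ?_ hv2⟩
    refine Finset.card_nbij' (fun u => (![u 0, -u 1] : Site 2)) (fun u => (![u 0, -u 1] : Site 2))
      (fun u hu => ?_) (fun u hu => ?_) (fun u _ => conjGeom_refl_refl u)
      (fun u _ => conjGeom_refl_refl u)
    · rw [Finset.mem_coe, Finset.mem_filter, SimpleGraph.mem_neighborFinset] at hu ⊢
      refine ⟨?_, fun h => hu.2 ((conjGeom_mem_closureFinset_iff_refl hc hδ u).2 h)⟩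
      rw [← conjGeom_adj_refl_iff, conjGeom_refl_refl]
      exact hu.1
    · rw [Finset.mem_coe, Finset.mem_filter, SimpleGraph.mem_neighborFinset] at hu ⊢
      exact ⟨(conjGeom_adj_refl_iff v u).2 hu.1,
        fun h => hu.2 ((conjGeom_refl_mem_closureFinset_iff hc hδ u).1 h)⟩

/-! ### The registered stub -/

/-- **Stub `stub_conjGeometry` (conjugate geometry) of line `excursion-kernel-covariance`.** (1) Every
conformal rectangle `R` has a complex-conjugate copy `R'` (`z ∈ Ω' ↔ conj z ∈ Ω`,
`∂Ω'(t) = conj (∂Ω(t))`, same marks); (2) along that relation rectilinearity, flat marks and admissible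
windows transfer, the orientation at the flat mark `a` flips from "carrier on the left of `u`" to
"carrier on the right of `conj u`", and the lattice reflection `v ↦ (v₀, -v₁)` carries the boundary
row of `V_δ(R)` into that of `V_δ(R')`. [folklore] -/
theorem stub_conjGeometry :
    (∀ R : ConformalRectangle, ∃ R' : ConformalRectangle,
        (∀ z : ℂ, z ∈ R'.carrier ↔ (starRingEnd ℂ) z ∈ R.carrier) ∧
          (∀ t : ℝ, R'.boundary t = (starRingEnd ℂ) (R.boundary t)) ∧ (∀ i : Fin 4, R'.mark i = R.mark i)) ∧
    ∀ R R' : ConformalRectangle,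
      ((∀ z : ℂ, z ∈ R'.carrier ↔ (starRingEnd ℂ) z ∈ R.carrier) ∧
          (∀ t : ℝ, R'.boundary t = (starRingEnd ℂ) (R.boundary t)) ∧ (∀ i : Fin 4, R'.mark i = R.mark i)) →
        (IsRectilinear R → IsRectilinear R') ∧ (FlatMarks R → FlatMarks R') ∧
        (∀ σ σ' : ℝ, AdmissibleRange R σ σ' → AdmissibleRange R' σ σ') ∧
        ((∃ u : ℂ, (u = 1 ∨ u = Complex.I ∨ u = -1 ∨ u = -Complex.I) ∧ ∃ r : ℝ, 0 < r ∧
            (∀ t t' : ℝ, R.mark 0 - r < t → t < t' → t' < R.mark 0 + r →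
              0 < ((R.boundary t' - R.boundary t) / u).re ∧
                ((R.boundary t' - R.boundary t) / u).im = 0) ∧
            (∀ z : ℂ, dist z (R.pt 0) < r →
              (z ∈ R.carrier ↔ 0 < ((z - R.pt 0) / u).im))) →
          (∃ u : ℂ, (u = 1 ∨ u = Complex.I ∨ u = -1 ∨ u = -Complex.I) ∧ ∃ r : ℝ, 0 < r ∧
            (∀ t t' : ℝ, R'.mark 0 - r < t → t < t' → t' < R'.mark 0 + r →
              0 < ((R'.boundary t' - R'.boundary t) / u).re ∧
                ((R'.boundary t' - R'.boundary t) / u).im = 0) ∧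
            (∀ z : ℂ, dist z (R'.pt 0) < r →
              (z ∈ R'.carrier ↔ 0 < -((z - R'.pt 0) / u).im)))) ∧
        (∀ (δ : ℝ) (v : Site 2), v ∈ boundaryRow R δ → (![v 0, -v 1] : Site 2) ∈ boundaryRow R' δ) := by
  refine ⟨conjGeom_exists, fun R R' h => ?_⟩
  obtain ⟨hc, hb, hm⟩ := h
  exact ⟨conjGeom_isRectilinear hc, conjGeom_flatMarks hc hb hm, conjGeom_admissibleRange hc hb hm,
    conjGeom_orientation hc hb hm, conjGeom_boundaryRow hc⟩

end Summit.CriticalPhenomena.CardyFormulaZ2.Cruxes.RectilinearCardy.ExcursionKernelCovariance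

end
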